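import Mathlib
import HarnessLib
import Literature.Analysis.FunctionSpaces.SmoothParametricIntegral
import Literature.Analysis.FluidPDE.VectorCalculus

/-!
# Route UnthreadedDoor · crux `PoloidalLiouville` (stmt-NavierStokesRegularity-1222, shared with
# route ThreadingFlux) · LINE «antidynamo» v2 — stub `stub_toroidalPotential` (2a), file 2/3:
# chord integrals of the radial pull-back form depend smoothly on time, radius and endpoints

Seat ns-es-p1 g4 (director-ns KEY-NS #139 (b)), `--supports stmt-NavierStokesRegularity-1222 --as helper`;
formalisation plan of ns-qj-p1 g3 (`TOROIDAL-POTENTIAL-PLAN.md`). Registered skeleton of record: planner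
ns-idea-6 g5, `PoloidalLiouville_antidynamo_birth_v2.lean` (sha16 `4ebf5683127baf3c`), stub
`StubToroidalPotential`. File 1/3 (`UnthreadedDoorToroidalPotentialClosed`) showed that the pull-back field
`G_{t,r}(z) = ‖z‖⁻² (z × Ω(t, (r/‖z‖) z))` of a sphere-tangent solenoidal `Ω(t, ·)` is a gradient on
`ℝ³ ∖ {0}`; the toroidal potential of file 3/3 is a chord integral of `G_{t,‖x‖}` from the pole `‖x‖ e₃`
to `x`. THIS FILE supplies its joint smoothness:

* `contDiffOn_parametric_intervalIntegral_of_isOpen` — LOCAL differentiation under the integral sign: if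
  `H : ℝ × P → F` is `C^∞` on an open `U ⊇ [a, b] × V` (`V` open, `P` finite dimensional), then
  `p ↦ ∫ σ in a..b, H (σ, p)` is `C^∞` on `V`. (The tree's
  `Literature.Analysis.FunctionSpaces.contDiff_parametric_intervalIntegral` is the global statement; here
  it is localised by two smooth cut-offs — one in `σ`, `≡ 1` on `[a, b]`, one in `p`, `≡ 1` near the
  point — whose supports lie in a metric tube around `[a, b] × {p₀}` inside `U`.)
* `contDiffOn_pullbackForm_spaceTime` — `(t, r, z) ↦ G_{t,r}(z)` is `C^∞` on `{t < 0} × ℝ × {z ≠ 0}`.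
* `contDiffOn_chordIntegral` — for smooth parameter maps `τ` (time), `ρ` (radius), `A`, `B` (endpoints),
  `p ↦ ∫₀¹ ⟪G_{τ p, ρ p}(A p + s(B p − A p)), B p − A p⟫ ds` is `C^∞` wherever `τ < 0` and the chord
  `[A p, B p]` avoids the origin.

HONEST FRAMING: calculus lemmas serving one kinematic stub of a line whose wall (`stub_scalarLiouville`)
is OPEN. Nothing here bears on `PoloidalLiouville`, on the UnthreadedDoor Target, or on Navier–Stokes
regularity; no summit statement is proved here.

References: L. C. Evans, Partial Differential Equations, 2nd ed. (2010), App. C.4 (differentiation under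
the integral sign, cut-offs); G. Backus, Rev. Geophys. 24 (1986), §2 (toroidal potentials).
-/

noncomputable section

open Set Filter Function Metric MeasureTheory intervalIntegral
open scoped Topology RealInnerProductSpace ContDiff

set_option linter.dupNamespace false

namespace Summit.NavierStokesRegularity.NavierStokesRegularity.Theorems.PoloidalLiouville

open Literature.Analysis.FluidPDE

section LocalParametric

variable {P : Type*} [NormedAddCommGroup P] [NormedSpace ℝ P] [FiniteDimensional ℝ P]
variable {F : Type*} [NormedAddCommGroup F] [NormedSpace ℝ F]

/-- **Local smooth dependence on parameters (differentiation under the integral sign).** If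
`H : ℝ × P → F` is `C^∞` on an open set `U ⊇ [a, b] × V` with `V` open, then
`p ↦ ∫ σ in a..b, H (σ, p)` is `C^∞` on `V`. Reduced to the global statement
`Literature.Analysis.FunctionSpaces.contDiff_parametric_intervalIntegral` by two smooth cut-offs (one in `σ`,
`≡ 1` on `[a, b]`; one in `p`, `≡ 1` near the point), supported inside `U` by the tube lemma.
[folklore] -/
theorem contDiffOn_parametric_intervalIntegral_of_isOpen {H : ℝ × P → F} {U : Set (ℝ × P)}
    {V : Set P} (hU : IsOpen U) (hV : IsOpen V) {a b : ℝ} (hab : a ≤ b) (hsub : Icc a b ×ˢ V ⊆ U)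
    (hH : ContDiffOn ℝ ∞ H U) : ContDiffOn ℝ ∞ (fun p => ∫ σ in a..b, H (σ, p)) V := by
  intro p₀ hp₀
  suffices h : ContDiffAt ℝ ∞ (fun p => ∫ σ in a..b, H (σ, p)) p₀ from h.contDiffWithinAt
  -- a metric tube `[a − ε/2, b + ε/2] × B(p₀, ε)` inside `U`
  have hK : IsCompact (Icc a b ×ˢ ({p₀} : Set P)) := isCompact_Icc.prod isCompact_singleton
  obtain ⟨ε, hε, hεU⟩ := hK.exists_thickening_subset_open hU
    (fun q hq => hsub ⟨hq.1, by rw [mem_singleton_iff.1 hq.2]; exact hp₀⟩)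
  have htube : ∀ σ ∈ Icc (a - ε / 2) (b + ε / 2), ∀ p : P, dist p p₀ < ε → (σ, p) ∈ U := by
    intro σ hσ p hp
    have hσ' : ∃ σ' ∈ Icc a b, dist σ σ' < ε := by
      refine ⟨max a (min σ b), ⟨le_max_left _ _, max_le hab (min_le_right _ _)⟩, ?_⟩
      rw [Real.dist_eq, abs_lt]
      rcases le_total a σ with h | h
      · rw [max_eq_right (le_min h hab)]
        rcases le_total σ b with h' | h'
        · rw [min_eq_left h']; constructor <;> linarith
        · rw [min_eq_right h']; constructor <;> linarith [hσ.2]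
      · rw [max_eq_left ((min_le_left _ _).trans h)]; constructor <;> linarith [hσ.1]
    obtain ⟨σ', hσ', hd⟩ := hσ'
    refine hεU (mem_thickening_iff.2 ⟨(σ', p₀), ⟨hσ', rfl⟩, ?_⟩)
    rw [Prod.dist_eq]
    exact max_lt hd hp
  -- cut-off in `σ`: `≡ 1` on `[a, b]`, supported in `(a − ε/2, b + ε/2)`
  have h4 : 0 < ε / 4 := by positivity
  set ψ : ℝ → ℝ := fun σ =>
    Real.smoothTransition ((σ - a + ε / 2) / (ε / 4)) *
      Real.smoothTransition ((b + ε / 2 - σ) / (ε / 4)) with hψ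
  have hψs : ContDiff ℝ ∞ ψ := by
    apply ContDiff.mul <;> refine Real.smoothTransition.contDiff.comp ?_ <;> fun_prop
  have hψ1 : ∀ σ ∈ uIcc a b, ψ σ = 1 := by
    intro σ hσ
    rw [uIcc_of_le hab] at hσ
    change Real.smoothTransition _ * Real.smoothTransition _ = 1
    rw [Real.smoothTransition.one_of_one_le, Real.smoothTransition.one_of_one_le, mul_one]
    · rw [le_div_iff₀ h4]; linarith [hσ.2]
    · rw [le_div_iff₀ h4]; linarith [hσ.1]
  have hψ0 : ∀ σ, ψ σ ≠ 0 → σ ∈ Ioo (a - ε / 2) (b + ε / 2) := by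
    intro σ hσ
    change Real.smoothTransition _ * Real.smoothTransition _ ≠ 0 at hσ
    simp only [ne_eq, mul_eq_zero, Real.smoothTransition.zero_iff_nonpos, not_or, not_le] at hσ
    have h1 := (div_pos_iff_of_pos_right h4).1 hσ.1
    have h2 := (div_pos_iff_of_pos_right h4).1 hσ.2
    constructor <;> linarith
  have hψt : tsupport ψ ⊆ Icc (a - ε / 2) (b + ε / 2) :=
    closure_minimal (fun σ hσ => Ioo_subset_Icc_self (hψ0 σ hσ)) isClosed_Icc
  -- cut-off in `p`: `≡ 1` near `p₀`, supported in `B(p₀, ε) ∩ V`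
  obtain ⟨f, hfs, -, hfd, -, hf1⟩ := exists_contDiff_tsupport_subset (n := (⊤ : ℕ∞))
    (s := ball p₀ ε ∩ V) (inter_mem (ball_mem_nhds p₀ hε) (hV.mem_nhds hp₀))
  set χ : P → ℝ := fun p => Real.smoothTransition (4 * f p - 2) with hχ
  have hχs : ContDiff ℝ ∞ χ := by
    refine Real.smoothTransition.contDiff.comp ?_
    fun_prop
  have hχ1 : ∀ᶠ p in 𝓝 p₀, χ p = 1 := by
    have ho : IsOpen {p : P | 3 / 4 < f p} := isOpen_lt continuous_const hfd.continuous
    filter_upwards [ho.mem_nhds (show (3 : ℝ) / 4 < f p₀ by rw [hf1]; norm_num)] with p hp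
    exact Real.smoothTransition.one_of_one_le (by change (3 : ℝ) / 4 < f p at hp; linarith)
  have hχt : tsupport χ ⊆ ball p₀ ε ∩ V := by
    refine (closure_mono fun p hp => ?_).trans hfs
    rw [mem_support] at hp ⊢
    intro h0
    apply hp
    change Real.smoothTransition _ = 0
    rw [h0]
    exact Real.smoothTransition.zero_of_nonpos (by norm_num)
  -- the cut-off integrand is globally smooth
  set Hc : ℝ × P → F := fun q => (ψ q.1 * χ q.2) • H q with hHc
  have hHcs : ContDiff ℝ ∞ Hc := by
    rw [contDiff_iff_contDiffAt]
    intro q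
    by_cases hq : q ∈ U
    · exact (((hψs.comp contDiff_fst).mul (hχs.comp contDiff_snd)).contDiffAt).smul
        (hH.contDiffAt (hU.mem_nhds hq))
    · -- outside `U` one of the two cut-offs vanishes identically near `q`
      have hev : (fun q' : ℝ × P => ψ q'.1 * χ q'.2) =ᶠ[𝓝 q] fun _ => 0 := by
        by_cases h1 : q.1 ∈ tsupport ψ
        · have h2 : q.2 ∉ tsupport χ := fun h2 =>
            hq (htube q.1 (hψt h1) q.2 (mem_ball.1 (hχt h2).1))
          have := (continuous_snd.tendsto q).eventually (notMem_tsupport_iff_eventuallyEq.1 h2)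
          exact this.mono fun q' hq' => by simp [hq']
        · have := (continuous_fst.tendsto q).eventually (notMem_tsupport_iff_eventuallyEq.1 h1)
          exact this.mono fun q' hq' => by simp [hq']
      refine (contDiffAt_const (c := (0 : F))).congr_of_eventuallyEq ?_
      exact hev.mono fun q' hq' => by simp only [hHc, hq', zero_smul]
  -- differentiate under the integral sign, then remove the cut-offs near `p₀`
  have hsmooth := Literature.Analysis.FunctionSpaces.contDiff_parametric_intervalIntegral hHcs a b
  refine (hsmooth.contDiffAt (x := p₀)).congr_of_eventuallyEq ?_
  filter_upwards [hχ1] with p hp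
  refine intervalIntegral.integral_congr fun σ hσ => ?_
  simp only [hHc, hp, hψ1 σ hσ, mul_one, one_smul]

end LocalParametric

section Chord

variable {P : Type*} [NormedAddCommGroup P] [NormedSpace ℝ P] [FiniteDimensional ℝ P]

/-- Joint smoothness of the radial pull-back field `(t, r, z) ↦ ‖z‖⁻² • (z × Ω(t, (r/‖z‖) z))` on
`{t < 0} × ℝ × {z ≠ 0}` for a field `Ω` jointly smooth on `(−∞, 0) × ℝ³`. [folklore] -/
theorem contDiffOn_pullbackForm_spaceTime
    {Ω : ℝ → EuclideanSpace ℝ (Fin 3) → EuclideanSpace ℝ (Fin 3)}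
    (hΩ : ContDiffOn ℝ ∞ (uncurry Ω) (Iio 0 ×ˢ univ)) :
    ContDiffOn ℝ ∞
      (fun q : ℝ × ℝ × EuclideanSpace ℝ (Fin 3) =>
        (‖q.2.2‖ ^ 2)⁻¹ • cross q.2.2 (Ω q.1 ((q.2.1 / ‖q.2.2‖) • q.2.2)))
      {q | q.1 < 0 ∧ q.2.2 ≠ 0} := by
  intro q hq
  have hz : q.2.2 ≠ 0 := hq.2
  have hO : IsOpen {q : ℝ × ℝ × EuclideanSpace ℝ (Fin 3) | q.1 < 0 ∧ q.2.2 ≠ 0} :=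
    (isOpen_Iio.preimage continuous_fst).inter
      (isOpen_ne.preimage (continuous_snd.comp continuous_snd))
  refine ContDiffAt.contDiffWithinAt ?_
  have hn : ContDiffAt ℝ ∞ (fun q : ℝ × ℝ × EuclideanSpace ℝ (Fin 3) => ‖q.2.2‖) q :=
    (contDiffAt_norm ℝ hz).comp q (contDiffAt_snd.comp q contDiffAt_snd)
  have hφ : ContDiffAt ℝ ∞ (fun q : ℝ × ℝ × EuclideanSpace ℝ (Fin 3) => (‖q.2.2‖ ^ 2)⁻¹) q :=
    (hn.pow 2).inv (pow_ne_zero _ (norm_ne_zero_iff.2 hz))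
  have hπ : ContDiffAt ℝ ∞
      (fun q : ℝ × ℝ × EuclideanSpace ℝ (Fin 3) => (q.2.1 / ‖q.2.2‖) • q.2.2) q :=
    ((contDiffAt_fst.comp q contDiffAt_snd).div hn (norm_ne_zero_iff.2 hz)).smul
      (contDiffAt_snd.comp q contDiffAt_snd)
  have hΩq : ContDiffAt ℝ ∞
      (fun q : ℝ × ℝ × EuclideanSpace ℝ (Fin 3) => Ω q.1 ((q.2.1 / ‖q.2.2‖) • q.2.2)) q := by
    have h1 : ContDiffAt ℝ ∞ (uncurry Ω) (q.1, (q.2.1 / ‖q.2.2‖) • q.2.2) :=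
      hΩ.contDiffAt ((isOpen_Iio.prod isOpen_univ).mem_nhds ⟨hq.1, mem_univ _⟩)
    exact h1.comp q (contDiffAt_fst.prodMk hπ)
  exact hφ.smul ((crossCLM.contDiff.contDiffAt.comp q (contDiffAt_snd.comp q contDiffAt_snd)).clm_apply
    hΩq)

/-- **Smoothness of chord integrals of the pull-back form.** For `Ω` jointly smooth on
`(−∞,0) × ℝ³` and smooth parameter maps `τ` (time), `ρ` (radius), `A`, `B` (chord endpoints) on a
finite-dimensional parameter space, the chord integral
`p ↦ ∫₀¹ ⟪G_{τ p, ρ p}(A p + s (B p − A p)), B p − A p⟫ ds` of `G_{t,r}(z) = ‖z‖⁻² (z × Ω(t, (r/‖z‖) z))`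
is `C^∞` on every open set of parameters where `τ < 0` and the chord `[A p, B p]` avoids the origin.
[folklore] -/
theorem contDiffOn_chordIntegral
    {Ω : ℝ → EuclideanSpace ℝ (Fin 3) → EuclideanSpace ℝ (Fin 3)}
    (hΩ : ContDiffOn ℝ ∞ (uncurry Ω) (Iio 0 ×ˢ univ)) {τ ρ : P → ℝ}
    {A B : P → EuclideanSpace ℝ (Fin 3)} (hτ : ContDiff ℝ ∞ τ) (hρ : ContDiff ℝ ∞ ρ)
    (hA : ContDiff ℝ ∞ A) (hB : ContDiff ℝ ∞ B) {V : Set P} (hV : IsOpen V)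
    (hVτ : ∀ p ∈ V, τ p < 0) (hVseg : ∀ p ∈ V, ∀ s ∈ Icc (0 : ℝ) 1, A p + s • (B p - A p) ≠ 0) :
    ContDiffOn ℝ ∞ (fun p => ∫ s in (0 : ℝ)..1,
      ⟪(‖A p + s • (B p - A p)‖ ^ 2)⁻¹ • cross (A p + s • (B p - A p))
          (Ω (τ p) ((ρ p / ‖A p + s • (B p - A p)‖) • (A p + s • (B p - A p)))), B p - A p⟫) V := by
  -- the integrand as a function on `ℝ × P`, smooth on `U = {τ < 0, chord point ≠ 0}`
  set U : Set (ℝ × P) := {q | τ q.2 < 0 ∧ A q.2 + q.1 • (B q.2 - A q.2) ≠ 0} with hU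
  have hγ : ContDiff ℝ ∞ fun q : ℝ × P => A q.2 + q.1 • (B q.2 - A q.2) :=
    (hA.comp contDiff_snd).add (contDiff_fst.smul ((hB.comp contDiff_snd).sub (hA.comp contDiff_snd)))
  have hUo : IsOpen U :=
    (isOpen_Iio.preimage (hτ.continuous.comp continuous_snd)).inter (isOpen_ne.preimage hγ.continuous)
  have hmaps : MapsTo (fun q : ℝ × P => (τ q.2, ρ q.2, A q.2 + q.1 • (B q.2 - A q.2))) U
      {q : ℝ × ℝ × EuclideanSpace ℝ (Fin 3) | q.1 < 0 ∧ q.2.2 ≠ 0} := fun q hq => ⟨hq.1, hq.2⟩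
  have hH : ContDiffOn ℝ ∞ (fun q : ℝ × P =>
      ⟪(‖A q.2 + q.1 • (B q.2 - A q.2)‖ ^ 2)⁻¹ • cross (A q.2 + q.1 • (B q.2 - A q.2))
          (Ω (τ q.2) ((ρ q.2 / ‖A q.2 + q.1 • (B q.2 - A q.2)‖) • (A q.2 + q.1 • (B q.2 - A q.2)))),
        B q.2 - A q.2⟫) U := by
    have h1 := (contDiffOn_pullbackForm_spaceTime hΩ).comp
      (((hτ.comp contDiff_snd).prodMk ((hρ.comp contDiff_snd).prodMk hγ)).contDiffOn) hmaps
    exact h1.inner ℝ (((hB.comp contDiff_snd).sub (hA.comp contDiff_snd)).contDiffOn)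
  have hsub : Icc (0 : ℝ) 1 ×ˢ V ⊆ U := fun q hq => ⟨hVτ q.2 hq.2, hVseg q.2 hq.2 q.1 hq.1⟩
  exact contDiffOn_parametric_intervalIntegral_of_isOpen hUo hV zero_le_one hsub hH

end Chord

end Summit.NavierStokesRegularity.NavierStokesRegularity.Theorems.PoloidalLiouville

end
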